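import Mathlib
import HarnessLib
import Summits.HubbardSuperconductivity.HubbardSuperconductivity.Theorems.KLProgrammePerturbedFermiCurveWindowJets

/-!
# Route `KLProgramme` — the frame's radius widths `W₁, W₂` on a level window in SHARP form (the free band's `U₀, R₁` in place of
# `π√2` and the uniform slope bound inside the two-frame lemmas)

Cell `gate-hubbard-kl`, seat hubbard-kl-k3c3-p3 (g7; row «implicit-function / monotonicity route for μ(n)»); engine-flow child `KLRegimeEngineV17F2`
(stmt-HubbardSuperconductivity-20437), stub (C).  `…WindowJets` transfers the certified free-band tower to the frame through the two-frame lemmas of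
`…TwoFrameBand`, whose order-1 width carries the UNIFORM slope bound `(4+κ₁)π√2/(Dt−κ₁) ≈ 28.5` of the free radius and whose order-2 width uses
`|u| ≤ π√2`: at frame sizes `A_j ≈ 10⁻³` this gives `W₁ ≈ 0.46`, `W₂ ≈ 46` (k3c3-p1 g7, KL STATUS l.3374: «W₂ … W₄ large»).  Feeding the
`…TwoFrameTower` lemmas DIRECTLY with the window's SHARP `U₀ = 2.826`, `R₁ = 1.549` gives (same `A_j`) `W₁♯ ≈ 0.07`, `W₂♯ ≈ 5.8`:

* `abs_deriv_frameRadius_sub_le_sharp`: `|u_K′(θ) − u′(θ)| ≤ ((4+2A₁)W₀ + (U₀ + R₁)(4W₀ + 2A₁))/(Dt_min − 2A₁)`, `W₀ = A₀/(Dt_min − 2A₁)`;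
* `abs_deriv_two_frameRadius_sub_le_sharp`: `|u_K″(θ) − u″(θ)| ≤ W₀ + (Δ₂K₁² + 8K₁(W₁+W₀) + Δ₁(2R₁′+U₀′) + 4(W₀+2W₁) + (R₂+U₀′)Δ₁)/(Dt_min − 2A₁)`
  with `Δ₁ = 4W₀ + 2A₁`, `Δ₂ = 4W₀ + 4A₂`, `U₀′ = U₀ + W₀`, `R₁′ = R₁ + W₁`, `K₁ = R₁′ + U₀′` (free-side sizes `‖Dε₀‖, ‖D²ε₀‖ ≤ 4`);
* `frame_polar_tower_of_window_sharp`: the window package to order 2 (`u_K ≤ U₀ + W₀`, `|u_K′| ≤ R₁ + W₁`, `|u_K″| ≤ R₂ + W₂` with the sharp widths)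
  — the `W₁, W₂` to feed `…WindowJetsJacobian`'s `Γ`'s and k3c3-p1's jet box.

Everything is PROVED; no definitions.  References: BGM 2006 §2.4 Lemma 2.1 (2.40) [cite: BenfattoGiulianiMastropietro2006].
-/

noncomputable section

namespace Summit.HubbardSuperconductivity.HubbardSuperconductivity.Theorems.PerturbedFermiCurve

set_option linter.dupNamespace false -- summit = problem name (single-conjunct summit), D-0017
set_option maxSynthPendingDepth 3 -- nested operator-norm instances

open Real Set
open Literature.MathematicalPhysics.QuantumLattice Literature.MathematicalPhysics.QuantumLattice.BandSectorCounting
open Summit.HubbardSuperconductivity.HubbardSuperconductivity.Theorems.DispersionFlow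
open Summit.HubbardSuperconductivity.HubbardSuperconductivity.Theorems.KLRegimeSplit

section Frame

variable {a b : ℝ} (B : BandBounds a b) {K : TrigPolyC4v} {A₀ A₁ A₂ : ℝ}
  (hA₀ : ∀ p : Momentum, ‖iteratedFDeriv ℝ 0 (frameShift K) p‖ ≤ A₀)
  (hA₁ : ∀ p : Momentum, ‖iteratedFDeriv ℝ 1 (frameShift K) p‖ ≤ A₁)
  (hA₂ : ∀ p : Momentum, ‖iteratedFDeriv ℝ 2 (frameShift K) p‖ ≤ A₂)
  (hA₁Dt : 2 * A₁ < B.Dtmin) {ν : ℝ} (hlo : a ≤ ν - A₀) (hhi : ν + A₀ ≤ b)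

include B hA₀ hA₁ hA₁Dt hlo hhi in
/-- **Order 1, SHARP**: with the free sizes `u(θ) ≤ U₀`, `|u′(θ)| ≤ R₁` (the certified table) and `W₀ = A₀/(Dt_min − 2A₁)`:
`|u_K′(θ) − u′(θ)| ≤ ((4+2A₁)W₀ + (U₀ + R₁)(4W₀ + 2A₁))/(Dt_min − 2A₁)`. [cite: BenfattoGiulianiMastropietro2006, §2.4 Lemma 2.1 (2.40)] -/
theorem abs_deriv_frameRadius_sub_le_sharp {θ U₀ R₁ : ℝ} (hU₀ : bandFermiRadius ν θ ≤ U₀) (hR₁ : |deriv (bandFermiRadius ν) θ| ≤ R₁) :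
    |deriv (perturbedFermiRadius (fun p : Fin 2 → ℝ => -K.eval p) ν) θ - deriv (bandFermiRadius ν) θ| ≤
      ((4 + 2 * A₁) * (A₀ / (B.Dtmin - 2 * A₁)) + (U₀ + R₁) * (4 * (A₀ / (B.Dtmin - 2 * A₁)) + 2 * A₁)) / (B.Dtmin - 2 * A₁) := by
  have hA0 : 0 ≤ A₀ := le_trans (norm_nonneg _) (hA₀ 0)
  have hδs : ContDiff ℝ 4 (0 : (Fin 2 → ℝ) → ℝ) := contDiff_const
  have hδs' : ContDiff ℝ 4 (fun p : Fin 2 → ℝ => -K.eval p) := contDiff_four_negEval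
  have hδ : ∀ k : Fin 2 → ℝ, (∀ i, |k i| ≤ π) → |(0 : (Fin 2 → ℝ) → ℝ) k| ≤ A₀ := fun k _ => by simpa using hA0
  have hδ' : ∀ k : Fin 2 → ℝ, (∀ i, |k i| ≤ π) → |(fun p : Fin 2 → ℝ => -K.eval p) k| ≤ A₀ := fun k _ => abs_negEval_le hA₀ k
  have hκ : ∀ k : Fin 2 → ℝ, (∀ i, |k i| ≤ π) → ‖fderiv ℝ (0 : (Fin 2 → ℝ) → ℝ) k‖ ≤ 2 * A₁ := fun k _ => by
    simp; exact le_trans (norm_nonneg _) (hA₁ 0)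
  have hκ' : ∀ k : Fin 2 → ℝ, (∀ i, |k i| ≤ π) → ‖fderiv ℝ (fun p : Fin 2 → ℝ => -K.eval p) k‖ ≤ 2 * A₁ :=
    fun k _ => norm_fderiv_negEval_le hA₁ k
  have hu := isBandFermiRadius_free B hA₀ hlo hhi
  have hv := isBandFermiRadius_frameRadius_perOrder B hA₀ hlo hhi
  have hE₀ : ∀ k : Fin 2 → ℝ, (∀ i, |k i| ≤ π) → |(fun p : Fin 2 → ℝ => -K.eval p) k - (0 : (Fin 2 → ℝ) → ℝ) k| ≤ A₀ :=
    fun k _ => by simpa using abs_negEval_le hA₀ k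
  obtain ⟨h4, h0⟩ := level_mem_band B hA₀ hlo hhi
  have hρ0 : 0 < B.Dtmin - 2 * A₁ := sub_pos.2 hA₁Dt
  have hUf : |bandFermiRadius ν θ| ≤ U₀ := by rw [abs_of_pos (bandFermiRadius_pos h4 h0 θ)]; exact hU₀
  have hΔ₁ : ‖fderiv ℝ (fun k : Fin 2 → ℝ => sqDispersion k + (fun p : Fin 2 → ℝ => -K.eval p) k)
        (perturbedFermiRadius (fun p : Fin 2 → ℝ => -K.eval p) ν θ • dir θ) -
      fderiv ℝ (fun k : Fin 2 → ℝ => sqDispersion k + (0 : (Fin 2 → ℝ) → ℝ) k) (bandFermiRadius ν θ • dir θ)‖ ≤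
      4 * (A₀ / (B.Dtmin - 2 * A₁)) + 2 * A₁ :=
    (norm_fderiv_two_roots_sub_le B hδs hδs' hδ hδ' hlo hhi hκ hA₁Dt hu hv hE₀ (κ₂ := 0) (E₁ := 2 * A₁) (fun k _ => by simp)
      (fun k _ => by simpa using norm_fderiv_negEval_le hA₁ k) θ).trans (le_of_eq (by ring))
  have he : ContDiff ℝ 4 (fun k : Fin 2 → ℝ => sqDispersion k + (0 : (Fin 2 → ℝ) → ℝ) k) := contDiff_pertBand hδs
  have he' : ContDiff ℝ 4 (fun k : Fin 2 → ℝ => sqDispersion k + (fun p : Fin 2 → ℝ => -K.eval p) k) := contDiff_pertBand hδs'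
  have hlev : ∀ ϑ, (fun k : Fin 2 → ℝ => sqDispersion k + (0 : (Fin 2 → ℝ) → ℝ) k) (bandFermiRadius ν ϑ • dir ϑ) = ν :=
    pertBand_level (δ := (0 : (Fin 2 → ℝ) → ℝ)) (μ := ν) hu
  have hlev' : ∀ ϑ, (fun k : Fin 2 → ℝ => sqDispersion k + (fun p : Fin 2 → ℝ => -K.eval p) k)
      (perturbedFermiRadius (fun p : Fin 2 → ℝ => -K.eval p) ν ϑ • dir ϑ) = ν :=
    pertBand_level (δ := fun p : Fin 2 → ℝ => -K.eval p) (μ := ν) hv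
  exact abs_deriv_sub_le_of_polar_levels he he'
    (contDiff_four_of_isRoot B hδs hδ hlo hhi hκ hA₁Dt hu) (contDiff_four_of_isRoot B hδs' hδ' hlo hhi hκ' hA₁Dt hv)
    hlev hlev' hρ0 (Dtmin_sub_le_fderiv_pertBand_dir B hδ' hlo hhi hκ' hv hδs' θ)
    (norm_fderiv_pertBand_le hδs' hκ' hv θ) hΔ₁ hUf hR₁ (abs_frameRadius_sub_bandFermiRadius_le B hA₀ hA₁ hA₁Dt hlo hhi θ)

include B hA₀ hA₁ hA₂ hA₁Dt hlo hhi in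
/-- **Order 2, SHARP**: with the free sizes `u(θ) ≤ U₀`, `|u′(θ)| ≤ R₁`, `|u″(θ)| ≤ R₂`, a width `W₁ ≥ |u_K′(θ) − u′(θ)|` (e.g. the sharp one),
`W₀ = A₀/(Dt_min − 2A₁)`, `U₀′ = U₀ + W₀`, `R₁′ = R₁ + W₁`, `K₁ = R₁′ + U₀′`, `Δ₁ = 4W₀ + 2A₁`, `Δ₂ = 4W₀ + 4A₂` (free-side sizes `‖Dε₀‖, ‖D²ε₀‖ ≤ 4`):
`|u_K″(θ) − u″(θ)| ≤ W₀ + (Δ₂K₁² + 2·4·K₁(W₁+W₀) + Δ₁(2R₁′+U₀′) + 4(W₀+2W₁) + (R₂+U₀′)Δ₁)/(Dt_min − 2A₁)`.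
[cite: BenfattoGiulianiMastropietro2006, §2.4 Lemma 2.1 (2.40)] -/
theorem abs_deriv_two_frameRadius_sub_le_sharp {θ U₀ R₁ R₂ W₁ : ℝ} (hU₀ : bandFermiRadius ν θ ≤ U₀)
    (hR₁ : |deriv (bandFermiRadius ν) θ| ≤ R₁) (hR₂ : |deriv (deriv (bandFermiRadius ν)) θ| ≤ R₂)
    (hW₁ : |deriv (perturbedFermiRadius (fun p : Fin 2 → ℝ => -K.eval p) ν) θ - deriv (bandFermiRadius ν) θ| ≤ W₁) :
    |deriv (deriv (perturbedFermiRadius (fun p : Fin 2 → ℝ => -K.eval p) ν)) θ - deriv (deriv (bandFermiRadius ν)) θ| ≤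
      A₀ / (B.Dtmin - 2 * A₁) +
        ((4 * (A₀ / (B.Dtmin - 2 * A₁)) + 4 * A₂) * ((R₁ + W₁) + (U₀ + A₀ / (B.Dtmin - 2 * A₁))) ^ 2 +
          2 * 4 * ((R₁ + W₁) + (U₀ + A₀ / (B.Dtmin - 2 * A₁))) * (W₁ + A₀ / (B.Dtmin - 2 * A₁)) +
          (4 * (A₀ / (B.Dtmin - 2 * A₁)) + 2 * A₁) * (2 * (R₁ + W₁) + (U₀ + A₀ / (B.Dtmin - 2 * A₁))) +
          4 * (A₀ / (B.Dtmin - 2 * A₁) + 2 * W₁) +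
          (R₂ + (U₀ + A₀ / (B.Dtmin - 2 * A₁))) * (4 * (A₀ / (B.Dtmin - 2 * A₁)) + 2 * A₁)) / (B.Dtmin - 2 * A₁) := by
  have hA0 : 0 ≤ A₀ := le_trans (norm_nonneg _) (hA₀ 0)
  have hδs : ContDiff ℝ 4 (0 : (Fin 2 → ℝ) → ℝ) := contDiff_const
  have hδs' : ContDiff ℝ 4 (fun p : Fin 2 → ℝ => -K.eval p) := contDiff_four_negEval
  have hδ : ∀ k : Fin 2 → ℝ, (∀ i, |k i| ≤ π) → |(0 : (Fin 2 → ℝ) → ℝ) k| ≤ A₀ := fun k _ => by simpa using hA0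
  have hδ' : ∀ k : Fin 2 → ℝ, (∀ i, |k i| ≤ π) → |(fun p : Fin 2 → ℝ => -K.eval p) k| ≤ A₀ := fun k _ => abs_negEval_le hA₀ k
  have hκ : ∀ k : Fin 2 → ℝ, (∀ i, |k i| ≤ π) → ‖fderiv ℝ (0 : (Fin 2 → ℝ) → ℝ) k‖ ≤ 2 * A₁ := fun k _ => by
    simp; exact le_trans (norm_nonneg _) (hA₁ 0)
  have hκ' : ∀ k : Fin 2 → ℝ, (∀ i, |k i| ≤ π) → ‖fderiv ℝ (fun p : Fin 2 → ℝ => -K.eval p) k‖ ≤ 2 * A₁ :=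
    fun k _ => norm_fderiv_negEval_le hA₁ k
  have hκ0 : ∀ k : Fin 2 → ℝ, (∀ i, |k i| ≤ π) → ‖fderiv ℝ (0 : (Fin 2 → ℝ) → ℝ) k‖ ≤ 0 := fun k _ => by simp
  have hu := isBandFermiRadius_free B hA₀ hlo hhi
  have hv := isBandFermiRadius_frameRadius_perOrder B hA₀ hlo hhi
  have hE₀ : ∀ k : Fin 2 → ℝ, (∀ i, |k i| ≤ π) → |(fun p : Fin 2 → ℝ => -K.eval p) k - (0 : (Fin 2 → ℝ) → ℝ) k| ≤ A₀ :=
    fun k _ => by simpa using abs_negEval_le hA₀ k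
  obtain ⟨h4, h0⟩ := level_mem_band B hA₀ hlo hhi
  have hρ0 : 0 < B.Dtmin - 2 * A₁ := sub_pos.2 hA₁Dt
  have hW₀ := abs_frameRadius_sub_bandFermiRadius_le B hA₀ hA₁ hA₁Dt hlo hhi θ
  have hW0nn : 0 ≤ A₀ / (B.Dtmin - 2 * A₁) := div_nonneg hA0 hρ0.le
  have hUf : |bandFermiRadius ν θ| ≤ U₀ := by rw [abs_of_pos (bandFermiRadius_pos h4 h0 θ)]; exact hU₀
  have hUf' : |bandFermiRadius ν θ| ≤ U₀ + A₀ / (B.Dtmin - 2 * A₁) := hUf.trans (le_add_of_nonneg_right hW0nn)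
  have hUv : |perturbedFermiRadius (fun p : Fin 2 → ℝ => -K.eval p) ν θ| ≤ U₀ + A₀ / (B.Dtmin - 2 * A₁) :=
    abs_le_add_of_abs_sub_le hUf hW₀
  have hR₁f : |deriv (bandFermiRadius ν) θ| ≤ R₁ + W₁ := hR₁.trans (le_add_of_nonneg_right ((abs_nonneg _).trans hW₁))
  have hR₁v := abs_le_add_of_abs_sub_le hR₁ hW₁
  have hE₁ : ‖fderiv ℝ (fun k : Fin 2 → ℝ => sqDispersion k + (0 : (Fin 2 → ℝ) → ℝ) k) (bandFermiRadius ν θ • dir θ)‖ ≤ 4 := by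
    simpa using norm_fderiv_pertBand_le hδs hκ0 hu θ
  have hE₂ : ‖fderiv ℝ (fderiv ℝ (fun k : Fin 2 → ℝ => sqDispersion k + (0 : (Fin 2 → ℝ) → ℝ) k)) (bandFermiRadius ν θ • dir θ)‖ ≤ 4 := by
    simpa using norm_fderiv_two_pertBand_le hδs hu (κ₂ := 0) (fun k _ => by simp) θ
  have hΔ₁ : ‖fderiv ℝ (fun k : Fin 2 → ℝ => sqDispersion k + (fun p : Fin 2 → ℝ => -K.eval p) k)
        (perturbedFermiRadius (fun p : Fin 2 → ℝ => -K.eval p) ν θ • dir θ) -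
      fderiv ℝ (fun k : Fin 2 → ℝ => sqDispersion k + (0 : (Fin 2 → ℝ) → ℝ) k) (bandFermiRadius ν θ • dir θ)‖ ≤
      4 * (A₀ / (B.Dtmin - 2 * A₁)) + 2 * A₁ :=
    (norm_fderiv_two_roots_sub_le B hδs hδs' hδ hδ' hlo hhi hκ hA₁Dt hu hv hE₀ (κ₂ := 0) (E₁ := 2 * A₁) (fun k _ => by simp)
      (fun k _ => by simpa using norm_fderiv_negEval_le hA₁ k) θ).trans (le_of_eq (by ring))
  have hΔ₂ : ‖fderiv ℝ (fderiv ℝ (fun k : Fin 2 → ℝ => sqDispersion k + (fun p : Fin 2 → ℝ => -K.eval p) k))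
        (perturbedFermiRadius (fun p : Fin 2 → ℝ => -K.eval p) ν θ • dir θ) -
      fderiv ℝ (fderiv ℝ (fun k : Fin 2 → ℝ => sqDispersion k + (0 : (Fin 2 → ℝ) → ℝ) k)) (bandFermiRadius ν θ • dir θ)‖ ≤
      4 * (A₀ / (B.Dtmin - 2 * A₁)) + 4 * A₂ :=
    (norm_fderiv_two_two_roots_sub_le B hδs hδs' hδ hδ' hlo hhi hκ hA₁Dt hu hv hE₀ (κ₃ := 0) (E₂ := 4 * A₂) (fun k _ => by simp)
      (fun k _ => by simpa using norm_fderiv_two_negEval_le hA₂ k) θ).trans (le_of_eq (by ring))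
  have he : ContDiff ℝ 4 (fun k : Fin 2 → ℝ => sqDispersion k + (0 : (Fin 2 → ℝ) → ℝ) k) := contDiff_pertBand hδs
  have he' : ContDiff ℝ 4 (fun k : Fin 2 → ℝ => sqDispersion k + (fun p : Fin 2 → ℝ => -K.eval p) k) := contDiff_pertBand hδs'
  have hlev : ∀ ϑ, (fun k : Fin 2 → ℝ => sqDispersion k + (0 : (Fin 2 → ℝ) → ℝ) k) (bandFermiRadius ν ϑ • dir ϑ) = ν :=
    pertBand_level (δ := (0 : (Fin 2 → ℝ) → ℝ)) (μ := ν) hu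
  have hlev' : ∀ ϑ, (fun k : Fin 2 → ℝ => sqDispersion k + (fun p : Fin 2 → ℝ => -K.eval p) k)
      (perturbedFermiRadius (fun p : Fin 2 → ℝ => -K.eval p) ν ϑ • dir ϑ) = ν :=
    pertBand_level (δ := fun p : Fin 2 → ℝ => -K.eval p) (μ := ν) hv
  exact abs_deriv_two_sub_le_of_polar_levels he he'
    (contDiff_four_of_isRoot B hδs hδ hlo hhi hκ hA₁Dt hu) (contDiff_four_of_isRoot B hδs' hδ' hlo hhi hκ' hA₁Dt hv)
    hlev hlev' hρ0 (Dtmin_sub_le_fderiv_pertBand_dir B hδ' hlo hhi hκ' hv hδs' θ) hE₁ hE₂ hΔ₁ hΔ₂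
    hUf' hUv hR₁f hR₁v hR₂ hW₀ hW₁

include B hA₀ hA₁ hA₂ hA₁Dt hlo hhi in
/-- **The window package to order 2 with the SHARP widths**: free window numbers `u ≤ U₀`, `|u′| ≤ R₁`, `|u″| ≤ R₂` on `[a, b]` and numbers
`W₁, W₂` dominating the sharp closed forms ⟹ at every angle: `|u_K − u| ≤ W₀`, `|u_K′ − u′| ≤ W₁`, `|u_K″ − u″| ≤ W₂`, `u_K ≤ U₀ + W₀`,
`|u_K′| ≤ R₁ + W₁`, `|u_K″| ≤ R₂ + W₂` (`W₀ = A₀/(Dt_min − 2A₁)`). [cite: BenfattoGiulianiMastropietro2006, §2.4 Lemma 2.1 (2.40)] -/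
theorem frame_polar_tower_of_window_sharp {U₀ R₁ R₂ W₁ W₂ : ℝ}
    (hU₀ : ∀ μ ∈ Icc a b, ∀ θ : ℝ, bandFermiRadius μ θ ≤ U₀)
    (hR₁ : ∀ μ ∈ Icc a b, ∀ θ : ℝ, |deriv (bandFermiRadius μ) θ| ≤ R₁)
    (hR₂ : ∀ μ ∈ Icc a b, ∀ θ : ℝ, |deriv (deriv (bandFermiRadius μ)) θ| ≤ R₂)
    (hW₁ : ((4 + 2 * A₁) * (A₀ / (B.Dtmin - 2 * A₁)) + (U₀ + R₁) * (4 * (A₀ / (B.Dtmin - 2 * A₁)) + 2 * A₁)) / (B.Dtmin - 2 * A₁) ≤ W₁)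
    (hW₂ : A₀ / (B.Dtmin - 2 * A₁) +
        ((4 * (A₀ / (B.Dtmin - 2 * A₁)) + 4 * A₂) * ((R₁ + W₁) + (U₀ + A₀ / (B.Dtmin - 2 * A₁))) ^ 2 +
          2 * 4 * ((R₁ + W₁) + (U₀ + A₀ / (B.Dtmin - 2 * A₁))) * (W₁ + A₀ / (B.Dtmin - 2 * A₁)) +
          (4 * (A₀ / (B.Dtmin - 2 * A₁)) + 2 * A₁) * (2 * (R₁ + W₁) + (U₀ + A₀ / (B.Dtmin - 2 * A₁))) +
          4 * (A₀ / (B.Dtmin - 2 * A₁) + 2 * W₁) +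
          (R₂ + (U₀ + A₀ / (B.Dtmin - 2 * A₁))) * (4 * (A₀ / (B.Dtmin - 2 * A₁)) + 2 * A₁)) / (B.Dtmin - 2 * A₁) ≤ W₂)
    (θ : ℝ) :
    |perturbedFermiRadius (fun p : Fin 2 → ℝ => -K.eval p) ν θ - bandFermiRadius ν θ| ≤ A₀ / (B.Dtmin - 2 * A₁) ∧
    |deriv (perturbedFermiRadius (fun p : Fin 2 → ℝ => -K.eval p) ν) θ - deriv (bandFermiRadius ν) θ| ≤ W₁ ∧
    |deriv (deriv (perturbedFermiRadius (fun p : Fin 2 → ℝ => -K.eval p) ν)) θ - deriv (deriv (bandFermiRadius ν)) θ| ≤ W₂ ∧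
    perturbedFermiRadius (fun p : Fin 2 → ℝ => -K.eval p) ν θ ≤ U₀ + A₀ / (B.Dtmin - 2 * A₁) ∧
    |deriv (perturbedFermiRadius (fun p : Fin 2 → ℝ => -K.eval p) ν) θ| ≤ R₁ + W₁ ∧
    |deriv (deriv (perturbedFermiRadius (fun p : Fin 2 → ℝ => -K.eval p) ν)) θ| ≤ R₂ + W₂ := by
  have hA0 : 0 ≤ A₀ := le_trans (norm_nonneg _) (hA₀ 0)
  have hν : ν ∈ Icc a b := ⟨by linarith, by linarith⟩
  have d0 := abs_frameRadius_sub_bandFermiRadius_le B hA₀ hA₁ hA₁Dt hlo hhi θ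
  have f1 := hR₁ ν hν θ
  have d1 := (abs_deriv_frameRadius_sub_le_sharp B hA₀ hA₁ hA₁Dt hlo hhi (hU₀ ν hν θ) f1).trans hW₁
  have r1 := abs_le_add_of_abs_sub_le f1 d1
  have f2 := hR₂ ν hν θ
  have d2 := (abs_deriv_two_frameRadius_sub_le_sharp B hA₀ hA₁ hA₂ hA₁Dt hlo hhi (hU₀ ν hν θ) f1 f2 d1).trans hW₂
  have r2 := abs_le_add_of_abs_sub_le f2 d2
  exact ⟨d0, d1, d2, (frameRadius_le_of_window B hA₀ hA₁ hA₁Dt hlo hhi hU₀ θ).1, r1, r2⟩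

end Frame

end Summit.HubbardSuperconductivity.HubbardSuperconductivity.Theorems.PerturbedFermiCurve

end
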